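import Summits.Ventures.AbcShadow.SH01.Row
import Summits.Ventures.AbcShadow.SH04.TwoSigned

/-!
# Venture AbcShadow — ROW SH-01 on the package AS AMENDED (two-signed `S_q`): `xⁿ + yⁿ = C z³`, `C ∈ {6, 12, 18, 36}`, prime `n ≥ 5`

HONEST FRAMING. Successor row file of the work-bound cell `abc-shadow` (typer seat `abc-shadow-typ-1`, lineage g3) to g0's `SH01/Row.lean`
(untouched). REASON: the cell's critic found a print erratum in [BVY04, Lemma 2.1 (ii)] (crit-1 g3 2026-08-28T22:57:25Z, memo
`pub/abc-shadow/crit-1-SH04-5911.md` sha16 812d2f7844b0b019 §2): [Prop 4.2]'s admissible set `S_q` is sound only in its TWO-SIGNED form, so g0's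
print-faithful one-signed `BVY04Package` is, as a hypothesis, stronger than what modularity + level lowering deliver; the critic's action for this
lineage: restate on `bvy04Allowed` and re-point the rows. g0's `sh01_core` ALREADY ran its kernel sieve on the two-signed sets (`Level972.lean`,
certificates on `bvy04Allowed`, reached from the one-signed package by `arisesMod_mono`); this file therefore only swaps the hypothesis:
`sh01_coreB` / `sh01_ofB` = g0's `sh01_core` / `sh01_of` VERBATIM with `hP : M.BVY04PackageA bvy04Allowed` (the package AS AMENDED,
`SH04/TwoSigned.lean`; WEAKER than print's: `bvy04PackageB_of_print`) and the monotonicity step dropped. Nothing else changes: same CM case tree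
([Prop 4.3], rank inputs `J₀(21)`, `J₀(39)`), same COMPUTED `DataComplete 972` and `CMBy 972 … (−3)`. `sh01_of` (print package) is recovered from
`sh01_ofB` by `bvy04PackageB_of_print` (it is g0's landed theorem; not restated here). Words: typed/kernel-checked REDUCTION; the newform data is COMPUTED (certificate
4a36c28685fe0350) and enters as `DataComplete`; print inputs are NAMED hypotheses (package AS AMENDED, two-signed); adjacent (signature (n,n,3)), NOT
abc; no side on IUT. AI-typed; weaker than expert refereeing of the cited inputs.
-/

namespace Summit.Ventures.AbcShadow

open Summit.Ventures.AbcSig (NewformModel FreyDatum OrbitData)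

/-- **Core of row SH-01 on the package AS AMENDED** (= g0's `sh01_core` with `hP : M.BVY04PackageA bvy04Allowed`; the kernel sieve of
`Level972.lean` was already on the two-signed sets). [cite: BennettVatsalYazdani2004, Lemma 3.4, Props 4.2-4.3, p.1407 (two-signed per the cell's erratum on Lemma 2.1 (ii))] -/
theorem sh01_coreB (M : CMNewformModel) (hP : M.BVY04PackageA bvy04Allowed) (h43 : M.BVY04Prop43)
    (hJ21 : M.BVY04RankInput21) (hJ39 : M.BVY04RankInput39)
    (hD : M.DataComplete 972 level972Orbits) (hCM : M.CMBy 972 level972CMOrbits (-3))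
    (C : ℕ) (hC : C ∈ ({6, 12, 18, 36} : Finset ℕ)) (n : ℕ) (hn : n.Prime) (h5 : 5 ≤ n)
    (x y z : ℤ) (hsol : IsPrimitiveSolution 1 1 C n x y z) (hnorm : ¬ (3 : ℤ) ∣ y ^ n - 2) : False := by
  obtain ⟨hC0, hC2, hC3, hC6, hlevel⟩ := sh01_coeff C hC
  have hodd : Odd n := hn.odd_of_ne_two (by omega)
  obtain ⟨hxy1, hxy2⟩ := sh01_xy_ne C n hC6 hodd x y z hsol
  obtain ⟨h3x, h3y⟩ := sh01_three_not_dvd C n hC3 x y z hsol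
  let S : FreyDatum := ⟨1, 1, C, n, x, y, z⟩
  have hpk := hP S .C3 Nat.one_pos Nat.one_pos hC0 (sh01_cubefree C hC)
    (fun q hq => ⟨fun h => hq.one_lt.ne' (Nat.eq_one_of_dvd_one ((dvd_pow_self q hn.ne_zero).trans h)),
      fun h => hq.one_lt.ne' (Nat.eq_one_of_dvd_one ((dvd_pow_self q hn.ne_zero).trans h))⟩)
    hn h5 (sh01_n_not_dvd C hC n hn h5) (show ¬ (3 : ℤ) ∣ ((1 : ℕ) : ℤ) * x by simpa using h3x)
    (show ¬ (3 : ℤ) ∣ ((1 : ℕ) : ℤ) * y ^ n - 2 by simpa using hnorm) hsol hxy1 hxy2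
    (show ¬ (1 * 1 = 27 ∧ n = 5) by norm_num) (show ¬ (1 * 1 = 3 ∧ n = 7) by norm_num)
    (show 3 ∣ C from hC3) 972 hlevel
  obtain ⟨⟨f, hf⟩, hmod⟩ := hpk
  have hmodB : M.ArisesMod f n bvy04Allowed := hmod f hf
  obtain ⟨o, ho, hfo⟩ := hD f
  have hgood := level972_wellformed o ho
  rw [mem_level972Orbits] at ho
  rcases ho with hoCM | rfl | rfl | rfl
  · -- the four CM orbits: [BVY04, Prop 4.3] case tree
    have hcm : M.HasCM 972 f (-3) := hCM f o hoCM hfo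
    have hsq : Squarefree (-3 : ℤ) := by
      rw [← Int.squarefree_natAbs]
      exact Nat.prime_three.squarefree
    rcases h43 S 972 f (-3) Nat.one_pos Nat.one_pos hC0 (sh01_cubefree C hC)
      (fun q hq => ⟨fun h => hq.one_lt.ne' (Nat.eq_one_of_dvd_one ((dvd_pow_self q hn.ne_zero).trans h)),
        fun h => hq.one_lt.ne' (Nat.eq_one_of_dvd_one ((dvd_pow_self q hn.ne_zero).trans h))⟩)
      hn h5 (show ¬ (3 : ℤ) ∣ ((1 : ℕ) : ℤ) * x by simpa using h3x)
      (show ¬ (3 : ℤ) ∣ ((1 : ℕ) : ℤ) * y ^ n - 2 by simpa using hnorm) hsol hxy1 hxy2 hf (by norm_num) hsq hcm with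
      ⟨-, h2, -⟩ | ⟨hn513, hsplit, halt⟩
    · exact h2 (show 2 ∣ 1 * 1 * C by simpa using hC2)
    · rcases hn513 with hn5 | hn7 | hn13
      · -- `n = 5` is inert in `ℚ(√−3)`
        have hn5' : S.n = 5 := hn5
        rw [hn5'] at hsplit
        simp only [QuadSplits, show (5 : ℕ) ≠ 2 by decide, if_false] at hsplit
        obtain ⟨-, x5, hx5⟩ := hsplit
        revert x5 hx5
        decide
      · rcases halt with hJ | ⟨⟨r, s, hs, hrs⟩, -⟩
        · have hn7' : S.n = 7 := hn7
          rw [hn7'] at hJ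
          exact hJ hJ21
        · have h3xy : (3 : ℤ) ∣ x * y := by
            have h3 : (3 : ℤ) ∣ 2 ^ r * 3 ^ s := Dvd.dvd.mul_left (dvd_pow_self 3 hs.ne') _
            rcases hrs with h | h
            · exact (show S.a * S.b = x * y from rfl) ▸ h ▸ h3
            · exact (show S.a * S.b = x * y from rfl) ▸ h ▸ h3.neg_right
          rcases Int.prime_three.dvd_or_dvd h3xy with h | h
          · exact h3x h
          · exact h3y h
      · rcases halt with hJ | ⟨⟨r, s, hs, hrs⟩, -⟩
        · have hn13' : S.n = 13 := hn13
          rw [hn13'] at hJ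
          exact hJ hJ39
        · have h3xy : (3 : ℤ) ∣ x * y := by
            have h3 : (3 : ℤ) ∣ 2 ^ r * 3 ^ s := Dvd.dvd.mul_left (dvd_pow_self 3 hs.ne') _
            rcases hrs with h | h
            · exact (show S.a * S.b = x * y from rfl) ▸ h ▸ h3
            · exact (show S.a * S.b = x * y from rfl) ▸ h ▸ h3.neg_right
          rcases Int.prime_three.dvd_or_dvd h3xy with h | h
          · exact h3x h
          · exact h3y h
  · exact M.not_arisesMod_of_eliminated f orbit_972_5 hfo n bvy04Allowed
      ((level972_nonCM_eliminated n hn h5).1) hgood hmodB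
  · exact M.not_arisesMod_of_eliminated f orbit_972_6 hfo n bvy04Allowed
      ((level972_nonCM_eliminated n hn h5).2.1) hgood hmodB
  · exact M.not_arisesMod_of_eliminated f orbit_972_7 hfo n bvy04Allowed
      ((level972_nonCM_eliminated n hn h5).2.2) hgood hmodB

/-- **Row SH-01 on the package AS AMENDED (two-signed; reduction theorem)**: under `BVY04PackageA bvy04Allowed` (weaker than print's
one-signed package), [Prop 4.3], the rank inputs `J₀(21)`, `J₀(39)`, the COMPUTED `DataComplete 972` and `CMBy`, `SH01` holds: `xⁿ + yⁿ = C z³`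
has no non-trivial primitive solution for `C ∈ {6, 12, 18, 36}` and prime `n ≥ 5`. ADJACENT, NOT abc.
[cite: Krawciow2011, Thm 1.1 (sharpened to every prime n ≥ 5, conditionally on the named inputs, package as amended)] -/
theorem sh01_ofB (M : CMNewformModel) (hP : M.BVY04PackageA bvy04Allowed) (h43 : M.BVY04Prop43)
    (hJ21 : M.BVY04RankInput21) (hJ39 : M.BVY04RankInput39)
    (hD : M.DataComplete 972 level972Orbits) (hCM : M.CMBy 972 level972CMOrbits (-3)) : SH01 := by
  intro C hC n hn h5
  obtain ⟨hC0, -, hC3, -, -⟩ := sh01_coeff C hC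
  rw [noPrimitiveSolution_iff C n hC0.ne']
  intro x y z hsol
  by_cases hnorm : (3 : ℤ) ∣ y ^ n - 2
  · -- swap `x ↔ y`: then `xⁿ ≡ −yⁿ ≡ −2 ≡ 1 (mod 3)`, so `xⁿ ≢ 2 (mod 3)`
    have hsol' : IsPrimitiveSolution 1 1 C n y x z := by
      obtain ⟨heq, hx, hy, hz, hxy, hxz, hyz⟩ := hsol
      exact ⟨by rw [← heq]; ring, hy, hx, hz, hxy.symm, hyz, hxz⟩
    refine sh01_coreB M hP h43 hJ21 hJ39 hD hCM C hC n hn h5 y x z hsol' ?_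
    obtain ⟨heq, -, -, -, -, -, -⟩ := hsol
    simp only [Nat.cast_one, one_mul] at heq
    have hCz : (3 : ℤ) ∣ (C : ℤ) * z ^ 3 := Dvd.dvd.mul_right (Int.natCast_dvd_natCast.mpr hC3) _
    obtain ⟨k, hk⟩ := hnorm
    obtain ⟨m, hm⟩ := hCz
    omega
  · exact sh01_coreB M hP h43 hJ21 hJ39 hD hCM C hC n hn h5 x y z hsol hnorm

end Summit.Ventures.AbcShadow
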